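import Summits.ValiantsHypothesis.ValiantsHypothesis.Theorems.KPlusLogSqLawTropicalGradedWalkChainThreeDefs
import Summits.ValiantsHypothesis.ValiantsHypothesis.Theorems.KPlusLogSqLawTropicalGradedWalkChainTwo
import Summits.ValiantsHypothesis.ValiantsHypothesis.Theorems.KPlusLogSqLawTropicalGradedWalkDomMGlue7
import Summits.ValiantsHypothesis.ValiantsHypothesis.Theorems.KPlusLogSqLawTropicalGradedWalkSignsM

/-!
# Route «KPlusLogSqLaw» — GRW-lite (all-`m` `K = 4` family): the FULL chain and the count `2m² ≤ B`

HONEST FRAMING.  Helper file `--supports` the crux `Summit.ValiantsHypothesis.ValiantsHypothesis.Theses.KPlusLogSqLaw.TropicalB`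
(item `stmt-ValiantsHypothesis-19771`, route `KPlusLogSqLaw`; cell `pub-symmetroid`, seat val-sym-trop-p3 g15, 2026-08-29), on top of
`…ChainThreeDefs`, `…ChainTwo` (the chain over the phases `w ≤ n`), `…DomMGlue7` (`isDominant_MD/MX/MT`) and `…SignsM` (sign alternation in
phase `m`).  It is a CENSUS-SIDE (lower-bound) statement about the tropical row `(m, 4)`; it proves nothing about `TropicalB` in its window
(an upper bound), the cell's `K = 4` fork, `WeakLifting`, the doors, `MatrixDescartes` or `VP ≠ VNP`.

CONTENT.  The full chain `seqR3 n` of the GRW-lite design (`D(1,0,0) → ⋯ → T(m,m,m)`, `m = n + 1`, `lenR3 n + 1 = 2m² + 1` states) is a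
sign-alternating chain of unique optima at strictly increasing slopes (`validR3_seqR3`, `theta_lt_nxt3`, `isDominant_validR3`,
`termSign_nxt3`), hence **`TropRootLawAt m 4 B → 2·m² ≤ B` for every `m ≥ 2`** (`grw3_le_of_tropRootLawAt_four`; `two_mul_lenR3`:
`lenR3 n = 2(n+1)²`).  This completes the lineage's GRW-lite programme (g14 design, g15 certificates): the located all-`m` floor of the
`K = 4` row has leading coefficient `2`.
-/

set_option linter.dupNamespace false
set_option autoImplicit false

namespace Summit.ValiantsHypothesis.ValiantsHypothesis.Theorems.LacunarySymmetroidMatrixDescartes.TropicalCensus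

namespace GradedWalk

open Summit.ValiantsHypothesis.ValiantsHypothesis.Theorems.MatrixDescartes.Negative

variable (n : ℕ)

/-! ### bookkeeping -/

/-- the chain starts at `D(1,0,0)`. -/
theorem seqR3_zero : seqR3 n 0 = (1, 0, 0) := rfl

/-- the chain is the iteration of `nxt3`. -/
theorem seqR3_succ (k : ℕ) : seqR3 n (k + 1) = nxt3 n (seqR3 n k) := by
  unfold seqR3; rw [Function.iterate_succ_apply']

/-- in the phases `w ≤ n` the successor is `nxt2`. -/
theorem nxt3_of_le {s : ℕ × ℕ × ℕ} (h : s.1 ≤ n) : nxt3 n s = nxt2 s := by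
  unfold nxt3; rw [if_pos h]

/-- in phase `m` the successor is `nxtM`. -/
theorem nxt3_of_top {s : ℕ × ℕ × ℕ} (h : s.1 = n + 1) : nxt3 n s = nxtM s := by
  unfold nxt3; rw [if_neg (by omega)]

/-- `nxt2` stays in its phase or moves to the start of the next one. -/
theorem nxt2_phase {s : ℕ × ℕ × ℕ} (h : ValidR2 s) :
    ((nxt2 s).1 = s.1 ∧ ValidR2 (nxt2 s)) ∨ (s.2.1 = s.1 ∧ s.2.2 = s.1 ∧ nxt2 s = (s.1 + 1, 0, 0)) := by
  have hv := validR2_nxt2 h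
  obtain ⟨w, u, t⟩ := s
  dsimp only at hv ⊢
  simp only [ValidR2] at h
  by_cases h1 : u < w
  · left
    refine ⟨?_, hv⟩
    simp only [nxt2, if_pos h1]
    split_ifs <;> rfl
  · by_cases h2 : t < w
    · left
      refine ⟨?_, hv⟩
      simp only [nxt2, if_neg h1, if_pos h2]
    · right
      refine ⟨by omega, by omega, ?_⟩
      simp only [nxt2, if_neg h1, if_neg h2]

/-- the last state of the chain. -/
theorem idxR3_last : idxR3 n (n + 1, n + 1, n + 1) = lenR3 n := by
  unfold idxR3 lenR3 posRM; dsimp only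
  rw [if_neg (by omega), show n + 1 + 1 = n + 2 from rfl]; omega

/-- `nxt3` preserves validity (before the last state) and raises the rank by one. -/
theorem validR3_nxt3 {s : ℕ × ℕ × ℕ} (h : ValidR3 n s) (hl : s ≠ (n + 1, n + 1, n + 1)) :
    ValidR3 n (nxt3 n s) ∧ idxR3 n (nxt3 n s) = idxR3 n s + 1 := by
  rcases h with ⟨hw, hv⟩ | hv
  · rw [nxt3_of_le n hw]
    have hidx := idxR2_nxt2 hv
    rcases nxt2_phase hv with ⟨h1, h2⟩ | ⟨h1, h2, h3⟩
    · refine ⟨Or.inl ⟨by omega, h2⟩, ?_⟩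
      unfold idxR3; rw [if_pos (by omega), if_pos hw, hidx]
    · rcases Nat.lt_or_ge s.1 n with hwn | hwn
      · refine ⟨Or.inl ⟨by rw [h3]; exact hwn, validR2_nxt2 hv⟩, ?_⟩
        unfold idxR3; rw [if_pos (by rw [h3]; exact hwn), if_pos hw, hidx]
      · have hsn : s.1 = n := by omega
        refine ⟨Or.inr ?_, ?_⟩
        · rw [h3]; unfold ValidM; dsimp only
          exact ⟨by omega, Or.inl ⟨by omega, le_rfl⟩⟩
        · unfold idxR3
          rw [h3]; dsimp only
          rw [if_neg (show ¬ (s.1 + 1 ≤ n) by omega), if_pos hw, ← hidx, h3]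
          unfold idxR2 posR2 posRM; dsimp only
          rw [hsn]; simp
  · obtain ⟨hw, hv⟩ := hv
    rw [nxt3_of_top n hw]
    obtain ⟨w, u, t⟩ := s
    dsimp only at hw hv hl
    subst hw
    simp only [ne_eq, Prod.mk.injEq, true_and] at hl
    have htri : ∀ k : ℕ, (k + 1) * (k + 1 + 1) / 2 = k * (k + 1) / 2 + (k + 1) := by
      intro k
      have : (k + 1) * (k + 1 + 1) = k * (k + 1) + 2 * (k + 1) := by ring
      rw [this, Nat.add_mul_div_left _ _ (by norm_num)]
    unfold nxtM; dsimp only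
    rcases hv with ⟨hu, htu⟩ | ⟨hu, htm⟩
    · rw [if_pos hu]
      by_cases h1 : t < u
      · rw [if_pos h1]
        refine ⟨Or.inr ⟨rfl, Or.inl ⟨hu, by dsimp only; omega⟩⟩, ?_⟩
        unfold idxR3 posRM; dsimp only
        simp only [if_neg (show ¬ (n + 1 ≤ n) by omega)]
        omega
      · rw [if_neg h1]
        have htu' : t = u := by omega
        subst htu'
        refine ⟨Or.inr ⟨rfl, ?_⟩, ?_⟩
        · rcases Nat.lt_or_ge (t + 1) (n + 1) with h2 | h2
          · exact Or.inl ⟨h2, Nat.zero_le _⟩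
          · exact Or.inr ⟨by dsimp only; omega, Nat.zero_le _⟩
        · unfold idxR3 posRM; dsimp only
          simp only [if_neg (show ¬ (n + 1 ≤ n) by omega)]
          rw [htri]; omega
    · subst hu
      rw [if_neg (lt_irrefl _)]
      by_cases h1 : t < n + 1
      · rw [if_pos h1]
        refine ⟨Or.inr ⟨rfl, Or.inr ⟨rfl, by dsimp only; omega⟩⟩, ?_⟩
        unfold idxR3 posRM; dsimp only
        simp only [if_neg (show ¬ (n + 1 ≤ n) by omega)]
        omega
      · exfalso; exact hl ⟨rfl, by omega⟩

/-- every state of the chain up to rank `lenR3 n` is valid and has the expected rank. -/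
theorem validR3_seqR3 (k : ℕ) (hk : k ≤ lenR3 n) : ValidR3 n (seqR3 n k) ∧ idxR3 n (seqR3 n k) = k := by
  induction k with
  | zero =>
    rw [seqR3_zero]
    rcases Nat.eq_zero_or_pos n with hn | hn
    · subst hn
      refine ⟨Or.inr ⟨rfl, Or.inl ⟨by dsimp only; omega, le_rfl⟩⟩, ?_⟩
      unfold idxR3 posRM; dsimp only
      simp [offP2]
    · refine ⟨Or.inl ⟨hn, by simp [ValidR2]⟩, ?_⟩
      unfold idxR3; dsimp only
      rw [if_pos (show 1 ≤ n by omega)]; simp [idxR2, offP2, posR2]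
  | succ k ih =>
    obtain ⟨hv, hidx⟩ := ih (by omega)
    have hne : seqR3 n k ≠ (n + 1, n + 1, n + 1) := by
      intro h; rw [h, idxR3_last] at hidx; omega
    rw [seqR3_succ]
    obtain ⟨hv', hidx'⟩ := validR3_nxt3 n hv hne
    exact ⟨hv', by rw [hidx', hidx]⟩

/-- the states of rank `< lenR3 n` are not the last state. -/
theorem seqR3_ne_last (k : ℕ) (hk : k < lenR3 n) : seqR3 n k ≠ (n + 1, n + 1, n + 1) := by
  intro h
  have := (validR3_seqR3 n k hk.le).2
  rw [h, idxR3_last] at this; omega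

/-! ### slopes increase -/

/-- `M₂ > 4m`. -/
theorem M2_gt : 4 * ((n : ℤ) + 1) < M2 n := by unfold M2; nlinarith

/-- the slope increases along the full chain. -/
theorem theta_lt_nxt3 {s : ℕ × ℕ × ℕ} (h : ValidR3 n s) (hl : s ≠ (n + 1, n + 1, n + 1)) :
    theta n s.1 s.2.1 s.2.2 < theta n (nxt3 n s).1 (nxt3 n s).2.1 (nxt3 n s).2.2 := by
  rcases h with ⟨hw, hv⟩ | ⟨hw, hv⟩
  · rw [nxt3_of_le n hw]; exact theta_lt_nxt2 n hv hw
  · rw [nxt3_of_top n hw]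
    obtain ⟨w, u, t⟩ := s
    dsimp only at hw hv hl ⊢
    subst hw
    simp only [ne_eq, Prod.mk.injEq, true_and] at hl
    have hM2 := M2_gt n
    unfold nxtM; dsimp only
    rcases hv with ⟨hu, htu⟩ | ⟨hu, htm⟩
    · rw [if_pos hu]
      by_cases h1 : t < u
      · rw [if_pos h1]; dsimp only
        rw [theta_MX n hu, theta_MX n hu]; unfold thM; push_cast; linarith
      · rw [if_neg h1]; dsimp only
        have htu' : t = u := by omega
        subst htu'
        rcases Nat.lt_or_ge (t + 1) (n + 1) with h2 | h2
        · rw [theta_MX n hu, theta_MX n h2]; unfold thM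
          have htz : (t : ℤ) ≤ n := by exact_mod_cast (show t ≤ n by omega)
          have e : M2 n * (((t + 1 : ℕ)) : ℤ) = M2 n * t + M2 n := by push_cast; ring
          rw [e]; push_cast; linarith
        · have ht : t + 1 = n + 1 := by omega
          rw [ht, theta_MX n hu, theta_MT n]; unfold thM thMT
          have htz : (t : ℤ) = n := by exact_mod_cast (show t = n by omega)
          have e : M2 n * ((n : ℤ) + 1) = M2 n * n + M2 n := by ring
          rw [e, htz]; push_cast; linarith
    · subst hu
      rw [if_neg (lt_irrefl _)]
      by_cases h1 : t < n + 1
      · rw [if_pos h1]; dsimp only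
        rw [theta_MT n, theta_MT n]; unfold thMT; push_cast; linarith
      · exfalso; exact hl ⟨rfl, by omega⟩

/-! ### dominance and sign alternation along the chain -/

/-- every state of the full chain is the unique optimum at its slope. -/
theorem isDominant_validR3 {s : ℕ × ℕ × ℕ} (h : ValidR3 n s) :
    IsDominant (dd n) (vv n) (ee n) (theta n s.1 s.2.1 s.2.2) (cterm n s.1 s.2.1 s.2.2) := by
  rcases h with ⟨hw, hv⟩ | ⟨hw, hv⟩
  · exact isDominant_validR2 n hv hw
  · obtain ⟨w, u, t⟩ := s
    dsimp only at hw hv ⊢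
    subst hw
    rcases hv with ⟨hu, htu⟩ | ⟨hu, htm⟩
    · rcases Nat.eq_zero_or_pos t with ht0 | ht0
      · subst ht0; exact isDominant_MD n u (by omega)
      · exact isDominant_MX n u t ht0 htu (by omega)
    · subst hu; exact isDominant_MT n t htm

/-- consecutive states of the full chain have terms of opposite signs (`1 ≤ n`). -/
theorem termSign_nxt3 (hn : 1 ≤ n) {s : ℕ × ℕ × ℕ} (h : ValidR3 n s) (hl : s ≠ (n + 1, n + 1, n + 1)) :
    termSign (ee n) (cterm n s.1 s.2.1 s.2.2) * termSign (ee n) (cterm n (nxt3 n s).1 (nxt3 n s).2.1 (nxt3 n s).2.2) < 0 := by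
  rcases h with ⟨hw, hv⟩ | ⟨hw, hv⟩
  · rw [nxt3_of_le n hw]
    rcases nxt2_phase hv with ⟨h1, _⟩ | ⟨h1, h2, h3⟩
    · exact termSign_nxt2 n hv (by omega)
    · rcases Nat.lt_or_ge s.1 n with hwn | hwn
      · exact termSign_nxt2 n hv (by rw [h3]; exact hwn)
      · have hsn : s.1 = n := by omega
        rw [h3]
        obtain ⟨w, u, t⟩ := s
        dsimp only at hsn h1 h2 ⊢
        rw [h1, h2, hsn]
        exact termSign_boundary_top n hn
  · rw [nxt3_of_top n hw]
    obtain ⟨w, u, t⟩ := s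
    dsimp only at hw hv hl ⊢
    subst hw
    simp only [ne_eq, Prod.mk.injEq, true_and] at hl
    unfold nxtM; dsimp only
    rcases hv with ⟨hu, htu⟩ | ⟨hu, htm⟩
    · rw [if_pos hu]
      by_cases h1 : t < u
      · rw [if_pos h1]; dsimp only
        exact termSign_M_step n u t (by omega) (by omega)
      · rw [if_neg h1]; dsimp only
        have htu' : t = u := by omega
        subst htu'
        rcases Nat.eq_zero_or_pos t with ht0 | ht0
        · subst ht0; exact termSign_M_turn0 n hn
        · exact termSign_M_turn n t ht0 (by omega)
    · subst hu
      rw [if_neg (lt_irrefl _)]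
      by_cases h1 : t < n + 1
      · rw [if_pos h1]; dsimp only
        exact termSign_MT_step n t (by omega)
      · exfalso; exact hl ⟨rfl, by omega⟩

/-! ### the count -/

/-- **the tropical row `(m, 4)`, `m = n + 1 ≥ 2`, is at least `lenR3 n`** (the full chain has `lenR3 n + 1` terms). -/
theorem lenR3_le_of_tropRootLawAt_four (hn : 1 ≤ n) (B : ℕ) (h : TropRootLawAt (n + 1) 4 B) : lenR3 n ≤ B := by
  set N := lenR3 n with hN
  exact h (dd n) (vv n) (ee n) N (fun k => theta n (seqR3 n k).1 (seqR3 n k).2.1 (seqR3 n k).2.2)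
    (fun k => cterm n (seqR3 n k).1 (seqR3 n k).2.1 (seqR3 n k).2.2)
    (fun i j l => by have := ee_natAbs_lt_two n i j l; omega)
    (by
      refine Fin.strictMono_iff_lt_succ.mpr fun k => ?_
      simp only [Fin.val_castSucc, Fin.val_succ]
      rw [seqR3_succ]
      exact theta_lt_nxt3 n (validR3_seqR3 n k (by omega)).1 (seqR3_ne_last n k (by omega)))
    (fun k => isDominant_validR3 n (validR3_seqR3 n k (by omega)).1)
    (fun k => by
      simp only [Fin.val_castSucc, Fin.val_succ]
      rw [seqR3_succ]
      exact termSign_nxt3 n hn (validR3_seqR3 n k (by omega)).1 (seqR3_ne_last n k (by omega)))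

/-- closed form of the length: `lenR3 n = 2 (n+1)²`. -/
theorem lenR3_eq (n : ℕ) : lenR3 n = 2 * (n + 1) ^ 2 := by
  unfold lenR3
  have h2 := two_mul_offP2 n
  have h4 : (n + 1) * (n + 2) = 2 * ((n + 1) * (n + 2) / 2) := by
    have : Even ((n + 1) * (n + 2)) := Nat.even_mul_succ_self (n + 1)
    obtain ⟨k, hk⟩ := this; omega
  have h5 : (n + 1) ^ 2 = n ^ 2 + 2 * n + 1 := by ring
  have h6 : (n + 1) * (n + 2) = n ^ 2 + 3 * n + 2 := by ring
  rw [h5]; rw [h6] at h4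
  generalize n ^ 2 = q at *
  omega

end GradedWalk

/-- **The GRW-lite floor of the `K = 4` tropical census row: leading coefficient `2`.**  Every bound `B` of the tropical row `(m, 4)`,
`m ≥ 2`, satisfies `2·m² ≤ B`: the full chain of the graded-rotation-walk design (all phases, the deep walks of the last phase included)
consists of `2m² + 1` sign-alternating unique optima at strictly increasing slopes.  Census side only (a lower bound for the row); nothing
here bears on `TropicalB` in its window or on the cell's `K = 4` fork. -/
theorem grw3_le_of_tropRootLawAt_four (m B : ℕ) (hm : 2 ≤ m) (h : TropRootLawAt m 4 B) : 2 * m ^ 2 ≤ B := by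
  obtain ⟨n, rfl⟩ : ∃ n, m = n + 1 := ⟨m - 1, by omega⟩
  have h1 := GradedWalk.lenR3_le_of_tropRootLawAt_four n (by omega) B h
  rw [GradedWalk.lenR3_eq] at h1
  exact h1

end Summit.ValiantsHypothesis.ValiantsHypothesis.Theorems.LacunarySymmetroidMatrixDescartes.TropicalCensus
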